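import Mathlib
import Literature.Analysis.Calculus.SmoothCutoff
import HarnessLib.Audit
import HarnessLib

/-!
# L3TimeExponentPincer — ring datum calculus VII: the explicit shape function `G`

Support kernel for the crux `L3CascadeJaw` (item stmt-NavierStokesRegularity-19499): the explicit
`C^∞` shape function entering the profile `F' = s^{-5/2} G` of the ring datum of
`lpPersistence_of_ringData` (`L3TimeExponentPincerRingDatumProfile`, `…Eta`):

  `G(s) = −κ (φ(s/a − 1) − φ(s/b − 1))`,  `φ = Real.smoothTransition`, `0 < a`, `2a ≤ b`, `0 ≤ κ`

(`a = ℓ²` the core scale, `b = L₀²` the outer scale).  Proved here: `G ∈ C^∞`; `G = 0` on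
`(−∞, a]` and on `[2b, ∞)`; `G = −κ` on the dipole zone `[2a, b]`; `−κ ≤ G ≤ 0`; the derivative
`G'(s) = −κ(φ'(s/a − 1)/a − φ'(s/b − 1)/b)` with `G' ≤ 0` on `s ≤ b` (core: `ω_θ/r ≥ 0`),
`G' ≥ 0` on `s ≥ 2a` (shell: `ω_θ/r ≤ 0`), and `|G'| ≤ κΦ/a` for any bound `Φ` of `φ'`
(tree: `Literature.Analysis.Calculus.exists_bound_deriv_smoothTransition`).  WHAT THIS IS NOT: one-variable calculus only.
-/

namespace Summit.NavierStokesRegularity.NavierStokesRegularity.Theorems.L3TimeExponentPincerRingDatumShape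

open Real Set Literature.Analysis.Calculus
open scoped ContDiff Topology

variable {G : ℝ → ℝ} {a b κ : ℝ}

/-- **Smoothness of the shape function.** -/
theorem contDiff_shape
    (hG : G = fun s => -κ * (Real.smoothTransition (s / a - 1) - Real.smoothTransition (s / b - 1))) :
    ContDiff ℝ ∞ G := by
  rw [hG]
  have h1 : ContDiff ℝ ∞ fun s : ℝ => Real.smoothTransition (s / a - 1) :=
    Real.smoothTransition.contDiff.comp ((contDiff_id.div_const a).sub contDiff_const)
  have h2 : ContDiff ℝ ∞ fun s : ℝ => Real.smoothTransition (s / b - 1) :=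
    Real.smoothTransition.contDiff.comp ((contDiff_id.div_const b).sub contDiff_const)
  exact contDiff_const.mul (h1.sub h2)

/-- `G = 0` on `(−∞, a]` (`0 < a ≤ b`). -/
theorem shape_eq_zero_of_le
    (hG : G = fun s => -κ * (Real.smoothTransition (s / a - 1) - Real.smoothTransition (s / b - 1)))
    (ha : 0 < a) (hab : a ≤ b) {s : ℝ} (hs : s ≤ a) : G s = 0 := by
  have hb : 0 < b := ha.trans_le hab
  have h1 : s / a - 1 ≤ 0 := by rw [sub_nonpos, div_le_one ha]; exact hs
  have h2 : s / b - 1 ≤ 0 := by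
    rw [sub_nonpos, div_le_one hb]; exact hs.trans hab
  rw [hG]
  simp only [Real.smoothTransition.zero_of_nonpos h1, Real.smoothTransition.zero_of_nonpos h2,
    sub_self, mul_zero]

/-- `G = 0` on `[2b, ∞)` (`0 < a ≤ b`). -/
theorem shape_eq_zero_of_ge
    (hG : G = fun s => -κ * (Real.smoothTransition (s / a - 1) - Real.smoothTransition (s / b - 1)))
    (ha : 0 < a) (hab : a ≤ b) {s : ℝ} (hs : 2 * b ≤ s) : G s = 0 := by
  have hb : 0 < b := ha.trans_le hab
  have h1 : 1 ≤ s / a - 1 := by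
    rw [le_sub_iff_add_le, le_div_iff₀ ha]; linarith
  have h2 : 1 ≤ s / b - 1 := by
    rw [le_sub_iff_add_le, le_div_iff₀ hb]; linarith
  rw [hG]
  simp only [Real.smoothTransition.one_of_one_le h1, Real.smoothTransition.one_of_one_le h2,
    sub_self, mul_zero]

/-- `G = −κ` on the dipole zone `[2a, b]`. -/
theorem shape_eq_neg_of_mem
    (hG : G = fun s => -κ * (Real.smoothTransition (s / a - 1) - Real.smoothTransition (s / b - 1)))
    (ha : 0 < a) (hab : a ≤ b) {s : ℝ} (hs : s ∈ Icc (2 * a) b) : G s = -κ := by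
  have hb : 0 < b := ha.trans_le hab
  have h1 : 1 ≤ s / a - 1 := by
    rw [le_sub_iff_add_le, le_div_iff₀ ha]; linarith [hs.1]
  have h2 : s / b - 1 ≤ 0 := by rw [sub_nonpos, div_le_one hb]; exact hs.2
  rw [hG]
  simp only [Real.smoothTransition.one_of_one_le h1, Real.smoothTransition.zero_of_nonpos h2,
    sub_zero, mul_one]

/-- `0 ≤ φ(s/a − 1) − φ(s/b − 1) ≤ 1` for `0 < a ≤ b`. -/
theorem shape_bracket_mem (ha : 0 < a) (hab : a ≤ b) (s : ℝ) :
    Real.smoothTransition (s / a - 1) - Real.smoothTransition (s / b - 1) ∈ Icc (0 : ℝ) 1 := by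
  have hb : 0 < b := ha.trans_le hab
  constructor
  · rw [sub_nonneg]
    rcases le_or_gt 0 s with hs | hs
    · exact Real.smoothTransition.monotone (by
        rw [sub_le_sub_iff_right]; exact div_le_div_of_nonneg_left hs ha hab)
    · rw [Real.smoothTransition.zero_of_nonpos (by
          rw [sub_nonpos, div_le_one hb]; linarith),
        Real.smoothTransition.zero_of_nonpos (by
          rw [sub_nonpos, div_le_one ha]; linarith)]
  · linarith [Real.smoothTransition.le_one (s / a - 1), Real.smoothTransition.nonneg (s / b - 1)]

/-- **`−κ ≤ G ≤ 0`** (`0 ≤ κ`, `0 < a ≤ b`). -/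
theorem shape_mem_Icc
    (hG : G = fun s => -κ * (Real.smoothTransition (s / a - 1) - Real.smoothTransition (s / b - 1)))
    (hκ : 0 ≤ κ) (ha : 0 < a) (hab : a ≤ b) (s : ℝ) : G s ∈ Icc (-κ) 0 := by
  have h := shape_bracket_mem ha hab s
  rw [hG]
  constructor <;> nlinarith [h.1, h.2]

/-- `|G| ≤ κ`. -/
theorem abs_shape_le
    (hG : G = fun s => -κ * (Real.smoothTransition (s / a - 1) - Real.smoothTransition (s / b - 1)))
    (hκ : 0 ≤ κ) (ha : 0 < a) (hab : a ≤ b) (s : ℝ) : |G s| ≤ κ := by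
  have h := shape_mem_Icc hG hκ ha hab s
  rw [abs_le]; exact ⟨h.1, h.2.trans hκ⟩

/-- `G ≤ 0`. -/
theorem shape_nonpos
    (hG : G = fun s => -κ * (Real.smoothTransition (s / a - 1) - Real.smoothTransition (s / b - 1)))
    (hκ : 0 ≤ κ) (ha : 0 < a) (hab : a ≤ b) (s : ℝ) : G s ≤ 0 :=
  (shape_mem_Icc hG hκ ha hab s).2

/-- **The derivative of the shape function**:
`G'(s) = −κ (φ'(s/a − 1)/a − φ'(s/b − 1)/b)`. -/
theorem deriv_shape
    (hG : G = fun s => -κ * (Real.smoothTransition (s / a - 1) - Real.smoothTransition (s / b - 1)))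
    (s : ℝ) :
    deriv G s = -κ * (deriv Real.smoothTransition (s / a - 1) / a -
      deriv Real.smoothTransition (s / b - 1) / b) := by
  have hφ : ∀ t, HasDerivAt Real.smoothTransition (deriv Real.smoothTransition t) t := fun t =>
    ((Real.smoothTransition.contDiff (n := 1)).differentiable (by norm_num) t).hasDerivAt
  have hl : ∀ c : ℝ, HasDerivAt (fun s : ℝ => s / c - 1) (1 / c) s := fun c => by
    simpa using ((hasDerivAt_id s).div_const c).sub_const 1
  have h1 : HasDerivAt (Real.smoothTransition ∘ fun s : ℝ => s / a - 1)
      (deriv Real.smoothTransition (s / a - 1) * (1 / a)) s := (hφ (s / a - 1)).comp s (hl a)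
  have h2 : HasDerivAt (Real.smoothTransition ∘ fun s : ℝ => s / b - 1)
      (deriv Real.smoothTransition (s / b - 1) * (1 / b)) s := (hφ (s / b - 1)).comp s (hl b)
  have h : HasDerivAt
      (fun s : ℝ => -κ * ((Real.smoothTransition ∘ fun s : ℝ => s / a - 1) s -
        (Real.smoothTransition ∘ fun s : ℝ => s / b - 1) s))
      (-κ * (deriv Real.smoothTransition (s / a - 1) * (1 / a) -
        deriv Real.smoothTransition (s / b - 1) * (1 / b))) s := (h1.sub h2).const_mul (-κ)
  have e : G = fun s : ℝ => -κ * ((Real.smoothTransition ∘ fun s : ℝ => s / a - 1) s -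
      (Real.smoothTransition ∘ fun s : ℝ => s / b - 1) s) := by
    rw [hG]; rfl
  rw [e, h.deriv]
  ring

/-- **Sign of `G'` on the core side**: `G'(s) ≤ 0` for `s ≤ b` (`0 ≤ κ`, `0 < a`). -/
theorem deriv_shape_nonpos_of_le
    (hG : G = fun s => -κ * (Real.smoothTransition (s / a - 1) - Real.smoothTransition (s / b - 1)))
    (hκ : 0 ≤ κ) (ha : 0 < a) (hab : a ≤ b) {s : ℝ} (hs : s ≤ b) : deriv G s ≤ 0 := by
  have hb : 0 < b := ha.trans_le hab
  rw [deriv_shape hG, deriv_smoothTransition_of_nonpos (t := s / b - 1)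
    (by rw [sub_nonpos, div_le_one hb]; exact hs), zero_div, sub_zero]
  have := Real.smoothTransition.monotone.deriv_nonneg (x := s / a - 1)
  have : 0 ≤ deriv Real.smoothTransition (s / a - 1) / a := div_nonneg this ha.le
  nlinarith

/-- **Sign of `G'` on the shell side**: `0 ≤ G'(s)` for `2a ≤ s` (`0 ≤ κ`, `0 < a ≤ b`). -/
theorem deriv_shape_nonneg_of_ge
    (hG : G = fun s => -κ * (Real.smoothTransition (s / a - 1) - Real.smoothTransition (s / b - 1)))
    (hκ : 0 ≤ κ) (ha : 0 < a) (hab : a ≤ b) {s : ℝ} (hs : 2 * a ≤ s) : 0 ≤ deriv G s := by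
  have hb : 0 < b := ha.trans_le hab
  rw [deriv_shape hG, deriv_smoothTransition_of_one_le (by
    rw [le_sub_iff_add_le, le_div_iff₀ ha]; linarith), zero_div, zero_sub]
  have := Real.smoothTransition.monotone.deriv_nonneg (x := s / b - 1)
  have : 0 ≤ deriv Real.smoothTransition (s / b - 1) / b := div_nonneg this hb.le
  nlinarith

/-- **Size of `G'`**: `|G'(s)| ≤ κΦ/a` for any bound `|φ'| ≤ Φ` (`0 ≤ κ`, `0 < a`, `2a ≤ b`). -/
theorem abs_deriv_shape_le
    (hG : G = fun s => -κ * (Real.smoothTransition (s / a - 1) - Real.smoothTransition (s / b - 1)))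
    (hκ : 0 ≤ κ) (ha : 0 < a) (hab : 2 * a ≤ b) {Φ : ℝ} (hΦ : ∀ t, |deriv Real.smoothTransition t| ≤ Φ)
    (s : ℝ) : |deriv G s| ≤ κ * Φ / a := by
  have hb : 0 < b := by linarith
  have hΦ0 : 0 ≤ Φ := (abs_nonneg _).trans (hΦ 0)
  rw [deriv_shape hG]
  rcases le_or_gt s b with hs | hs
  · rw [deriv_smoothTransition_of_nonpos (t := s / b - 1) (by rw [sub_nonpos, div_le_one hb]; exact hs),
      zero_div, sub_zero, abs_mul, abs_neg, abs_of_nonneg hκ, abs_div, abs_of_pos ha, mul_div_assoc]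
    exact mul_le_mul_of_nonneg_left (div_le_div_of_nonneg_right (hΦ _) ha.le) hκ
  · rw [deriv_smoothTransition_of_one_le (t := s / a - 1) (by
      rw [le_sub_iff_add_le, le_div_iff₀ ha]; linarith), zero_div, zero_sub, abs_mul, abs_neg,
      abs_of_nonneg hκ, abs_neg, abs_div, abs_of_pos hb, mul_div_assoc]
    refine mul_le_mul_of_nonneg_left ?_ hκ
    calc |deriv Real.smoothTransition (s / b - 1)| / b ≤ Φ / b :=
          div_le_div_of_nonneg_right (hΦ _) hb.le
      _ ≤ Φ / a := div_le_div_of_nonneg_left hΦ0 ha (by linarith)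

/-- **`G' = 0` on the dipole zone** `[2a, b]` (`0 < a ≤ b`): there `φ'(s/a − 1) = 0` (`s/a − 1 ≥ 1`)
and `φ'(s/b − 1) = 0` (`s/b − 1 ≤ 0`), so `ω_θ/r = −4s^{-3/2}G' = 0` — the exact irrotational-`η`
dipole zone separating the positive core (`a ≤ s ≤ 2a`) from the negative shell (`b ≤ s ≤ 2b`). -/
theorem deriv_shape_eq_zero_of_mem
    (hG : G = fun s => -κ * (Real.smoothTransition (s / a - 1) - Real.smoothTransition (s / b - 1)))
    (ha : 0 < a) (hab : a ≤ b) {s : ℝ} (hs : s ∈ Icc (2 * a) b) : deriv G s = 0 := by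
  have hb : 0 < b := ha.trans_le hab
  rw [deriv_shape hG, deriv_smoothTransition_of_one_le (t := s / a - 1) (by
      rw [le_sub_iff_add_le, le_div_iff₀ ha]; linarith [hs.1]),
    deriv_smoothTransition_of_nonpos (t := s / b - 1) (by rw [sub_nonpos, div_le_one hb]; exact hs.2)]
  ring

/-- `G' = 0` below the core: `s ≤ a` ⇒ `G'(s) = 0` (both `φ'` factors vanish). -/
theorem deriv_shape_eq_zero_of_le
    (hG : G = fun s => -κ * (Real.smoothTransition (s / a - 1) - Real.smoothTransition (s / b - 1)))
    (ha : 0 < a) (hab : a ≤ b) {s : ℝ} (hs : s ≤ a) : deriv G s = 0 := by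
  have hb : 0 < b := ha.trans_le hab
  rw [deriv_shape hG, deriv_smoothTransition_of_nonpos (t := s / a - 1) (by
      rw [sub_nonpos, div_le_one ha]; exact hs),
    deriv_smoothTransition_of_nonpos (t := s / b - 1) (by
      rw [sub_nonpos, div_le_one hb]; exact hs.trans hab)]
  ring

/-- `G' = 0` beyond the shell: `2b ≤ s` ⇒ `G'(s) = 0`. -/
theorem deriv_shape_eq_zero_of_ge
    (hG : G = fun s => -κ * (Real.smoothTransition (s / a - 1) - Real.smoothTransition (s / b - 1)))
    (ha : 0 < a) (hab : a ≤ b) {s : ℝ} (hs : 2 * b ≤ s) : deriv G s = 0 := by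
  have hb : 0 < b := ha.trans_le hab
  rw [deriv_shape hG, deriv_smoothTransition_of_one_le (t := s / a - 1) (by
      rw [le_sub_iff_add_le, le_div_iff₀ ha]; linarith),
    deriv_smoothTransition_of_one_le (t := s / b - 1) (by
      rw [le_sub_iff_add_le, le_div_iff₀ hb]; linarith)]
  ring

end Summit.NavierStokesRegularity.NavierStokesRegularity.Theorems.L3TimeExponentPincerRingDatumShape
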